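import Literature.MathematicalPhysics.QuantumLattice.HubbardRingSpinDecaySharp
import HarnessLib
import HarnessLib.Audit

/-!
# Hubbard ladder — Bounds: explicit correlation length of the transverse SPIN correlation on
# the one-dimensional Hubbard ring, `ξ_spin ≤ 4|t|/T` for `T ≤ 4|t|`, rate `≥ 1` for `T ≥ 4|t|`
# (bounds.tex Thm 10⁶ (e); magnetic twin of `RingExponentialClustering.lean`)

HONEST FRAMING (cell pub-hubbard): ladder R1–R4 with certified numbers; no claim on H/H₀. These
are bounds for a MODEL CLASS — the grand-canonical Hubbard model `hubbardTorusWith 1 L t U μ` on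
the ring `ℤ/Lℤ` (every `L ≥ 1`, all real `t, U, μ`, every `β ≥ 0`); no materials claim.
Companion text: `pub-hubbard/paper/bounds.tex` §Theorem 10 (Thm 10⁶ (e)); table
`pub-hubbard/pub-hubbard-bounds/BOUNDS.md` (row T8¹²).

## Relation to what the tree already proves (read this first)

The QUALITATIVE one-dimensional clause of Koma–Tasaki's eq. (4) is ALREADY a theorem of the
tree: `koma_tasaki_magnetic_holds` (`HubbardHubbardModelKomaTasakiProofs`, second conjunct of
`koma_tasaki_magnetic`) gives, for all `t, U, μ`, `β > 0`, uniformly in `L`,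
`|⟨S⁺_x S⁻_y⟩_{β,L}| ≤ 1 · exp(-dist(x,y)/(16β|t| + 1))` (prefactor `C = 1`, rate
`m_tree = 1/(16β|t| + 1)`, from the linear profile `exists_testFunction_one` with the charge
`q = 1/(16β|t|+1) ≤ 1` and the operator-norm a priori bound `norm_thermalCorr_siteSpinPlus_le`).
This file does NOT re-file that statement. What it files are the SHARPER EXPLICIT RATES obtained
from the free-charge bound of the Literature file `HubbardRingSpinDecaySharp` (this seat;
clamped-cone profile + the printed hopping norm `2|t|·#edges` of
`norm_thermalCorr_siteSpinPlus_le_sharp`):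
`|⟨S⁺_x S⁻_y⟩_{β,L}| ≤ e^{4q} exp(-[2q - 4β|t|(cosh q - 1)] dist(x,y))` for EVERY `q ≥ 0`.

* `RingSpinCorrelationLengthLowT` / `_holds` — `T ≤ 4|t|` (`1 ≤ 4β|t|`, `q = 1/(4β|t|)`):
  `≤ e^{1/(β|t|)} exp(-dist/(4β|t|))`, i.e. `ξ_spin(T) ≤ 4|t|/T`. Rate `1/(4β|t|)` versus the
  tree's `1/(16β|t|+1)`: the ratio is `4 + 1/(4β|t|) ≥ 4` (`lowT_rate_ge_four_mul_treeRate`);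
  the price is the prefactor `e^{1/(β|t|)} ∈ (1, e⁴]` instead of `1`; the crossover distance is
  `4(16b+1)/(12b+1) ∈ [5, 16/3)` (`b = β|t| ≥ 1/4`), so the new row is the sharper bound at
  EVERY distance `≥ 6`, uniformly in `T ≤ 4|t|` (`lowT_row_le_treeBound_of_six_le`), and the
  tree's at distances `≤ 5`; both hold.
* `RingSpinCorrelationLengthHighT` / `_holds` — `T ≥ 4|t|` (`4β|t| ≤ 1`, `q = 1`):
  `≤ e⁴ exp(-dist)`, rate `1` versus the tree's `1/(16β|t|+1) ∈ [1/5, 1)` (sharper beyond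
  distance `4 + 1/(4β|t|)`).

NOT claimed: optimality of `4|t|/T` (the free-fermion value at `U = 0` is `ξ = v_F/(πT) ≤
2|t|/(πT)`, a factor `2π` smaller); the longitudinal correlation `⟨S^z_x S^z_y⟩`; `T = 0`.

References (keys of `lean/references.bib`): KomaTasakiPRL1992 (Theorem eq. (4), one-dimensional
clause; eqs. (5)–(13); last paragraph of the proof); McBryanSpencer1977. Tree predecessors:
`koma_tasaki_magnetic_holds`, `le_exp_of_forall_testFunction_one`, `exists_testFunction_one`.
-/

noncomputable section

namespace Summit.HubbardSuperconductivity.HubbardLadder.Bounds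

open Matrix Finset NormedSpace
open Literature.MathematicalPhysics.QuantumLattice Literature.Probability.LatticeModels

open scoped Matrix.Norms.L2Operator ComplexOrder

/-- **Thm 10⁶ (e), low temperature (PROVED below).** On the Hubbard ring `ℤ/Lℤ` with Hamiltonian
`H(t,U) - μN`, for all real `t, U, μ`, `β ≥ 0` with `1 ≤ 4β|t|` (temperature `T ≤ 4|t|`),
uniformly in `L`: `|⟨S⁺_x S⁻_y⟩_{β,L}| ≤ e^{1/(β|t|)} exp(-dist(x,y)/(4β|t|))` — the transverse
spin correlation length is at most `4β|t| = 4|t|/T` (rate `≥ 4×` the tree's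
`koma_tasaki_magnetic_holds`, prefactor `≤ e⁴` instead of `1`). kind: support (PROVED). Why it
might fail: it cannot (proved); NOT claimed: optimality. Sources: KomaTasakiPRL1992 Theorem
eq. (4) (one-dimensional clause), eq. (13), note 9; McBryanSpencer1977; tree
`koma_tasaki_magnetic_holds`; this cell bounds.tex Thm 10⁶ (e). -/
@[conjecture] def RingSpinCorrelationLengthLowT : Prop :=
  ∀ (t U μ β : ℝ), 0 ≤ β → 1 ≤ 4 * (β * |t|) →
    ∀ (L : ℕ) [NeZero L] (x y : TorusSite 1 L),
      ‖(hubbardTorusWith 1 L t U μ).thermalCorr β (siteSpinPlus x) (siteSpinPlus y)ᴴ‖ ≤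
        Real.exp (1 / (β * |t|)) * Real.exp (-(1 / (4 * (β * |t|)) * (torusDist x y : ℝ)))

/-- **`RingSpinCorrelationLengthLowT` holds** (`norm_thermalCorr_siteSpinPlus_ring_le_exp_lowT`). -/
theorem ringSpinCorrelationLengthLowT_holds : RingSpinCorrelationLengthLowT :=
  fun t U μ β hβ hT L _ x y => norm_thermalCorr_siteSpinPlus_ring_le_exp_lowT L t U μ β hβ hT x y

/-- **Thm 10⁶ (e), high temperature (PROVED below).** On the Hubbard ring, for all real `t, U, μ`,
`β ≥ 0` with `4β|t| ≤ 1` (temperature `T ≥ 4|t|`, including `β = 0`), uniformly in `L`: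
`|⟨S⁺_x S⁻_y⟩_{β,L}| ≤ e⁴ exp(-dist(x,y))` — inverse correlation length `≥ 1` lattice unit
(the tree's `koma_tasaki_magnetic_holds` gives rate `1/(16β|t|+1) ∈ [1/5, 1)` with prefactor `1`).
kind: support (PROVED). Why it might fail: it cannot (proved). Sources: KomaTasakiPRL1992
Theorem eq. (4) (one-dimensional clause), p. 3249; tree `koma_tasaki_magnetic_holds`;
this cell bounds.tex Thm 10⁶ (e). -/
@[conjecture] def RingSpinCorrelationLengthHighT : Prop :=
  ∀ (t U μ β : ℝ), 0 ≤ β → 4 * (β * |t|) ≤ 1 →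
    ∀ (L : ℕ) [NeZero L] (x y : TorusSite 1 L),
      ‖(hubbardTorusWith 1 L t U μ).thermalCorr β (siteSpinPlus x) (siteSpinPlus y)ᴴ‖ ≤
        Real.exp 4 * Real.exp (-(torusDist x y : ℝ))

/-- **`RingSpinCorrelationLengthHighT` holds** (`norm_thermalCorr_siteSpinPlus_ring_le_exp_highT`). -/
theorem ringSpinCorrelationLengthHighT_holds : RingSpinCorrelationLengthHighT :=
  fun t U μ β hβ hT L _ x y => norm_thermalCorr_siteSpinPlus_ring_le_exp_highT L t U μ β hβ hT x y

/-- The honest comparison with the tree, as arithmetic: for `b = β|t| > 0` the low-temperature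
rate `1/(4b)` of `RingSpinCorrelationLengthLowT` is at least four times the rate `1/(16b+1)` of
`koma_tasaki_magnetic_holds` (and of `koma_tasaki_1d_holds`). [folklore] -/
theorem lowT_rate_ge_four_mul_treeRate {b : ℝ} (hb : 0 < b) :
    4 * (1 / (16 * b + 1)) ≤ 1 / (4 * b) := by
  rw [mul_one_div, div_le_div_iff₀ (by positivity) (by positivity)]
  linarith

/-- The crossover with the tree's bound, certified: for `b = β|t| > 0` and every distance `d ≥ 6`,
`e^{1/b} e^{-d/(4b)} ≤ e^{-d/(16b+1)}` — beyond six sites the row `RingSpinCorrelationLengthLowT`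
is sharper than `koma_tasaki_magnetic_holds` / `koma_tasaki_1d_holds` at every `T ≤ 4|t|`
(exponents: `1/b - d/(4b) ≤ -d/(16b+1) ⟺ 4(16b+1) ≤ d(12b+1)`). [folklore] -/
theorem lowT_row_le_treeBound_of_six_le {b d : ℝ} (hb : 0 < b) (hd : 6 ≤ d) :
    Real.exp (1 / b) * Real.exp (-(1 / (4 * b) * d)) ≤ Real.exp (-(1 / (16 * b + 1)) * d) := by
  rw [← Real.exp_add, Real.exp_le_exp]
  have hb4 : (0 : ℝ) < 4 * b := by positivity
  have h16 : (0 : ℝ) < 16 * b + 1 := by positivity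
  have key : 4 * (16 * b + 1) ≤ d * (12 * b + 1) := by nlinarith
  have e : -(1 / (16 * b + 1)) * d - (1 / b + -(1 / (4 * b) * d)) =
      (d * (12 * b + 1) - 4 * (16 * b + 1)) / (4 * b * (16 * b + 1)) := by
    field_simp
    ring
  have hnn : 0 ≤ (d * (12 * b + 1) - 4 * (16 * b + 1)) / (4 * b * (16 * b + 1)) :=
    div_nonneg (by linarith) (by positivity)
  linarith

/-- … and the qualitative clause (some `m > 0`, `C`, uniformly in `L`) follows from the two
explicit rows for every `β ≥ 0` (for `β > 0` it is the tree's `koma_tasaki_magnetic_holds`,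
with the better prefactor `C = 1`). [folklore] -/
theorem ringSpin_clustering_of_rows (t U μ β : ℝ) (hβ : 0 ≤ β) :
    ∃ m C : ℝ, 0 < m ∧ ∀ (L : ℕ) [NeZero L] (x y : TorusSite 1 L),
      ‖(hubbardTorusWith 1 L t U μ).thermalCorr β (siteSpinPlus x) (siteSpinPlus y)ᴴ‖ ≤
        C * Real.exp (-(m * (torusDist x y : ℝ))) := by
  rcases le_or_gt (1 : ℝ) (4 * (β * |t|)) with hlow | hhigh
  · have hb : 0 < β * |t| := by linarith
    refine ⟨1 / (4 * (β * |t|)), Real.exp (1 / (β * |t|)), by positivity, fun L _ x y => ?_⟩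
    simpa [neg_mul] using ringSpinCorrelationLengthLowT_holds t U μ β hβ hlow L x y
  · refine ⟨1, Real.exp 4, one_pos, fun L _ x y => ?_⟩
    simpa using ringSpinCorrelationLengthHighT_holds t U μ β hβ hhigh.le L x y

end Summit.HubbardSuperconductivity.HubbardLadder.Bounds

end
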